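import Summits.Ventures.YMGap.FlowData.TubeTorelonEnvelope
import HarnessLib

/-!
# Venture YMGap, track Y3 FLOW-DATA — against a gauge-invariant test function the transfer matrix element is the
# un-averaged electric bilinear form; the vacuum lower bound `‖T‖ ≥ e^{−|J|nP} c₀^N` (theorems only)

HONEST FRAMING: venture file of the cell `pub-ymgap` (QuantumFields programme), track Y3; companion THEOREMS for
`FlowData/TubeTransferOperator.lean` preparing the STRONG-COUPLING WINDOW for the typed torelon energy
(`FlowData/TubeStrongCouplingWindow.lean`).  Finite spatial torus, compact group, continuous unitary `ρ`; no
number, no row, nothing about limits or a mass gap.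

With `K(a,b) = m(a) (∫ e^{J elec(a,E,b)} dE) m(b)`, `m = e^{J mag/2}`, the temporal links `E` act on the earlier
slice by a gauge transformation (`elecSum_gaugeTransform_div`: `elec(a^E, E, b) = elec(a, 1, b)`), so that against a
GAUGE-INVARIANT `φ` they integrate out:

* **`inner_tubeTransferOperator_eq_of_gaugeInvariant`** — for `φ, g ∈ L²(slice)` with `φ ∘ (·)^γ = φ` a.e. for
  every gauge transformation `γ`:
  `⟪φ, T g⟫ = ∫ φ(a) m(a) (∫ ∏_e e^{J Re tr ρ(b_e a_e⁻¹)} m(b) g(b) db) da`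
  (two Fubini exchanges and one change of variables `a ↦ a^E`);
* `tubeTransferOperator_gaugeInvariant_ae` — every `T g` is such a `φ` (`gaugeOp_comp_tubeTransferOperator`);
* **`norm_tubeTransferOperator_ge`** — `e^{−|J| n P} c₀^N ≤ ‖T‖` (`c₀ = ∫ e^{J Re tr ρ}`, `N` links, `P` plaquettes;
  the constant test function, `inner_tubeTransferOperator_pathState` with the empty path).

References: M. Lüscher, Commun. Math. Phys. 54 (1977) 283 [cite: Luscher1977]; I. Montvay, G. Münster (1994) §3.2.6
[cite: MontvayMunster1994, §3.2.6]; M. Creutz, *Quarks, gluons and lattices* (1983) Ch. 9.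
-/

noncomputable section

open scoped BigOperators
open MeasureTheory Filter Function
open Literature.MathematicalPhysics.QuantumFieldTheory Literature.Analysis.OperatorTheory
open Literature.Barriers.QuantumFields

namespace Summit.Ventures.YMGap.FlowData

section Reduction

variable {G : Type*} [Group G] [TopologicalSpace G] [IsTopologicalGroup G] [CompactSpace G]
  [MeasurableSpace G] [BorelSpace G] [SecondCountableTopology G] {n : ℕ} (ρ : G →* Matrix (Fin n) (Fin n) ℂ)
  (J : ℝ) {k L : ℕ} [NeZero L]

omit [TopologicalSpace G] [IsTopologicalGroup G] [CompactSpace G] [MeasurableSpace G] [BorelSpace G]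
  [SecondCountableTopology G] [NeZero L] in
/-- `gaugeTransform 1 = id`. [folklore] -/
theorem gaugeTransform_one_eq (b : GaugeConfig k L G) : gaugeTransform (1 : Site k L → G) b = b := by
  funext e
  simp [gaugeTransform]

omit [TopologicalSpace G] [IsTopologicalGroup G] [CompactSpace G] [MeasurableSpace G] [BorelSpace G]
  [SecondCountableTopology G] in
/-- **The temporal links act on the earlier slice**: `elec(a^E, E, b) = elec(a, 1, b)`. [cite: Luscher1977] -/
theorem elecSum_gaugeTransform_left_self (E : Site k L → G) (a b : GaugeConfig k L G) :
    elecSum (d := k) (L := L) ρ (gaugeTransform E a) E b = elecSum (d := k) (L := L) ρ a 1 b := by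
  have h := elecSum_gaugeTransform_div (k := k) (L := L) ρ E 1 a b
  rwa [div_one, gaugeTransform_one_eq] at h

/-- **Every vector in the range of `T` is gauge invariant**: `(T g) ∘ (·)^γ = T g` a.e. (unitary continuous `ρ`).
[cite: Luscher1977] -/
theorem tubeTransferOperator_gaugeInvariant_ae (hρ : Continuous ρ) (hρu : ∀ g, ρ g ∈ Matrix.unitaryGroup (Fin n) ℂ)
    (g : Lp ℝ 2 (sliceMeasure G k L)) (γ : Site k L → G) :
    ∀ᵐ a ∂(sliceMeasure G k L),
      (tubeTransferOperator ρ J k L g : GaugeConfig k L G → ℝ) (gaugeTransform γ a) =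
        (tubeTransferOperator ρ J k L g : GaugeConfig k L G → ℝ) a := by
  have hmp : MeasurePreserving (gaugeTransform γ : GaugeConfig k L G → GaugeConfig k L G)
      (sliceMeasure G k L) (sliceMeasure G k L) := WilsonGauge.measurePreserving_gaugeTransform γ
  have hop := congrArg (fun A => A g) (gaugeOp_comp_tubeTransferOperator (k := k) (L := L) ρ J hρ hρu γ)
  simp only [ContinuousLinearMap.comp_apply] at hop
  have hop' : Lp.compMeasurePreserving (gaugeTransform γ : GaugeConfig k L G → GaugeConfig k L G) hmp
      (tubeTransferOperator ρ J k L g) = tubeTransferOperator ρ J k L g := hop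
  have h1 := Lp.coeFn_compMeasurePreserving (tubeTransferOperator ρ J k L g) hmp
  rw [hop'] at h1
  filter_upwards [h1] with a ha
  rw [← comp_apply (f := (tubeTransferOperator ρ J k L g : GaugeConfig k L G → ℝ)) (g := gaugeTransform γ) (x := a),
    ← ha]

omit [CompactSpace G] [MeasurableSpace G] [BorelSpace G] [SecondCountableTopology G] in
/-- Continuity of `(a, E, b) ↦ e^{J elec(a,E,b)}`, as a function on `(a, E) × b`. [folklore] -/
theorem continuous_exp_elecSum_pair (hρ : Continuous ρ) :
    Continuous fun q : (GaugeConfig k L G × (Site k L → G)) × GaugeConfig k L G =>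
      Real.exp (J * elecSum (d := k) (L := L) ρ q.1.1 q.1.2 q.2) :=
  Real.continuous_exp.comp (continuous_const.mul (Continuous.comp
    (g := fun r : GaugeConfig k L G × (Site k L → G) × GaugeConfig k L G => elecSum (d := k) (L := L) ρ r.1 r.2.1 r.2.2)
    (f := fun q : (GaugeConfig k L G × (Site k L → G)) × GaugeConfig k L G => (q.1.1, q.1.2, q.2))
    (continuous_elecSum_triple ρ hρ)
    ((continuous_fst.comp continuous_fst).prodMk ((continuous_snd.comp continuous_fst).prodMk continuous_snd))))

omit [TopologicalSpace G] [IsTopologicalGroup G] [CompactSpace G] [MeasurableSpace G] [BorelSpace G]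
  [SecondCountableTopology G] in
/-- `|e^{J elec(a,E,b)}| ≤ e^{|J| n N}` (unitary `ρ`, `N` links). [folklore] -/
theorem exp_elecSum_le (hρu : ∀ g, ρ g ∈ Matrix.unitaryGroup (Fin n) ℂ) (a b : GaugeConfig k L G)
    (E : Site k L → G) :
    Real.exp (J * elecSum (d := k) (L := L) ρ a E b) ≤ Real.exp (|J| * (n * Fintype.card (Edge k L))) := by
  refine Real.exp_le_exp.2 ?_
  have h1 : |elecSum (d := k) (L := L) ρ a E b| ≤ n * Fintype.card (Edge k L) := by
    unfold elecSum
    refine (Finset.abs_sum_le_sum_abs _ _).trans ?_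
    have h : ∀ x : Site k L, |∑ i : Fin k, (ρ (E x * b (x, i) * (E (x + Pi.single i 1))⁻¹ * (a (x, i))⁻¹)).trace.re|
        ≤ ∑ _i : Fin k, (n : ℝ) := fun x =>
      (Finset.abs_sum_le_sum_abs _ _).trans (Finset.sum_le_sum fun i _ =>
        (Complex.abs_re_le_norm _).trans (FiniteTemperature.norm_trace_le_of_mem_unitaryGroup (hρu _)))
    refine (Finset.sum_le_sum fun x _ => h x).trans (le_of_eq ?_)
    simp only [Finset.sum_const, Finset.card_univ, Fintype.card_prod]
    push_cast
    ring
  calc J * elecSum (d := k) (L := L) ρ a E b ≤ |J * elecSum (d := k) (L := L) ρ a E b| := le_abs_self _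
    _ = |J| * |elecSum (d := k) (L := L) ρ a E b| := abs_mul _ _
    _ ≤ |J| * (n * Fintype.card (Edge k L)) := mul_le_mul_of_nonneg_left h1 (abs_nonneg _)

/-- **THE MATRIX ELEMENT AGAINST A GAUGE-INVARIANT TEST FUNCTION.**  For `φ, g ∈ L²(slice)` with `φ` gauge invariant
a.e. under every gauge transformation,
`⟪φ, T g⟫ = ∫ φ(a) m(a) (∫ ∏_e e^{J Re tr ρ(b_e a_e⁻¹)} m(b) g(b) db) da`, `m = e^{J mag/2}`: the temporal links are
absorbed into `φ` by `a ↦ a^E` and integrate to one. [cite: Luscher1977] [cite: MontvayMunster1994, §3.2.6] -/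
theorem inner_tubeTransferOperator_eq_of_gaugeInvariant (hρ : Continuous ρ)
    (hρu : ∀ g, ρ g ∈ Matrix.unitaryGroup (Fin n) ℂ) (φ g : Lp ℝ 2 (sliceMeasure G k L))
    (hφ : ∀ γ : Site k L → G, ∀ᵐ a ∂(sliceMeasure G k L),
      (φ : GaugeConfig k L G → ℝ) (gaugeTransform γ a) = (φ : GaugeConfig k L G → ℝ) a) :
    @inner ℝ _ _ φ (tubeTransferOperator ρ J k L g) =
      ∫ a, ((φ : GaugeConfig k L G → ℝ) a * Real.exp (J / 2 * magSum (d := k) (L := L) ρ a)) *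
        ∫ b, (∏ e : Edge k L, Real.exp (J * (ρ (b e * (a e)⁻¹)).trace.re)) *
          (Real.exp (J / 2 * magSum (d := k) (L := L) ρ b) * (g : GaugeConfig k L G → ℝ) b)
          ∂(sliceMeasure G k L) ∂(sliceMeasure G k L) := by
  set m : GaugeConfig k L G → ℝ := fun a => Real.exp (J / 2 * magSum (d := k) (L := L) ρ a) with hm
  set h : GaugeConfig k L G → ℝ := fun b => m b * (g : GaugeConfig k L G → ℝ) b with hh
  have hmc : Continuous m := Real.continuous_exp.comp (continuous_const.mul (continuous_magSum (d := k) (L := L) ρ hρ))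
  obtain ⟨Cm, hCm⟩ := isCompact_univ.exists_bound_of_continuousOn hmc.continuousOn
  have hgi : Integrable (g : GaugeConfig k L G → ℝ) (sliceMeasure G k L) := (Lp.memLp g).integrable one_le_two
  have hφi : Integrable (φ : GaugeConfig k L G → ℝ) (sliceMeasure G k L) := (Lp.memLp φ).integrable one_le_two
  have hhi : Integrable h (sliceMeasure G k L) := by
    have := hgi.bdd_mul hmc.aestronglyMeasurable (Eventually.of_forall fun b => hCm b (Set.mem_univ _))
    exact this
  have hφmi : Integrable (fun a => (φ : GaugeConfig k L G → ℝ) a * m a) (sliceMeasure G k L) :=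
    hφi.mul_bdd hmc.aestronglyMeasurable (Eventually.of_forall fun b => hCm b (Set.mem_univ _))
  set CE : ℝ := Real.exp (|J| * (n * Fintype.card (Edge k L))) with hCE
  have hexp_le : ∀ a b E, Real.exp (J * elecSum (d := k) (L := L) ρ a E b) ≤ CE := fun a b E => exp_elecSum_le ρ J hρu a b E
  have hexp_nn : ∀ a b E, 0 ≤ Real.exp (J * elecSum (d := k) (L := L) ρ a E b) := fun a b E => (Real.exp_pos _).le
  -- Step 0: the kernel formula
  rw [inner_tubeTransferOperator_eq_integral J k L hρ φ g]
  -- Step 1: for fixed `a`, swap the `b` and `E` integrals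
  set F : GaugeConfig k L G → (Site k L → G) → ℝ := fun a E =>
    ∫ b, Real.exp (J * elecSum (d := k) (L := L) ρ a E b) * h b ∂(sliceMeasure G k L) with hF
  have hstep1 : ∀ a : GaugeConfig k L G, ∫ b, sliceKernel (d := k) (L := L) ρ J J a b * (g : GaugeConfig k L G → ℝ) b ∂(sliceMeasure G k L) =
      m a * ∫ E, F a E ∂(Measure.pi fun _ : Site k L => haarProbability G) := by
    intro a
    have h1 : ∀ b, sliceKernel (d := k) (L := L) ρ J J a b * (g : GaugeConfig k L G → ℝ) b =
        m a * ∫ E, Real.exp (J * elecSum (d := k) (L := L) ρ a E b) * h b ∂(Measure.pi fun _ : Site k L => haarProbability G) := by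
      intro b
      simp only [sliceKernel, hh, hm]
      rw [integral_mul_const]
      ring
    simp_rw [h1]
    rw [integral_const_mul]
    congr 1
    -- Fubini on `μS × μE`
    have hc : Continuous fun p : GaugeConfig k L G × (Site k L → G) =>
        Real.exp (J * elecSum (d := k) (L := L) ρ a p.2 p.1) :=
      Continuous.comp (g := fun q : (GaugeConfig k L G × (Site k L → G)) × GaugeConfig k L G =>
          Real.exp (J * elecSum (d := k) (L := L) ρ q.1.1 q.1.2 q.2))
        (f := fun p : GaugeConfig k L G × (Site k L → G) => ((a, p.2), p.1))
        (continuous_exp_elecSum_pair ρ J hρ) ((continuous_const.prodMk continuous_snd).prodMk continuous_fst)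
    have hint : Integrable (uncurry fun (b : GaugeConfig k L G) (E : Site k L → G) =>
        Real.exp (J * elecSum (d := k) (L := L) ρ a E b) * h b) ((sliceMeasure G k L).prod (Measure.pi fun _ : Site k L => haarProbability G)) := by
      have h0 : Integrable (fun p : GaugeConfig k L G × (Site k L → G) => h p.1 * (1 : ℝ)) ((sliceMeasure G k L).prod (Measure.pi fun _ : Site k L => haarProbability G)) :=
        hhi.mul_prod (integrable_const 1)
      have h0' := h0.bdd_mul hc.aestronglyMeasurable (c := CE)
        (Eventually.of_forall fun p => by rw [Real.norm_of_nonneg (hexp_nn _ _ _)]; exact hexp_le _ _ _)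
      refine h0'.congr (Eventually.of_forall fun p => ?_)
      simp only [uncurry, mul_one]
    exact integral_integral_swap hint
  simp_rw [hstep1]
  -- Step 2: swap the `a` and `E` integrals
  have hFc : Continuous (uncurry F) := by
    refine continuous_of_dominated (bound := fun b => CE * ‖h b‖) ?_ ?_ ?_ ?_
    · intro p
      exact (Continuous.comp (g := fun q : (GaugeConfig k L G × (Site k L → G)) × GaugeConfig k L G =>
          Real.exp (J * elecSum (d := k) (L := L) ρ q.1.1 q.1.2 q.2))
        (f := fun b : GaugeConfig k L G => (p, b))
        (continuous_exp_elecSum_pair ρ J hρ) (continuous_const.prodMk continuous_id)).aestronglyMeasurable.mul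
        hhi.aestronglyMeasurable
    · intro p
      refine Eventually.of_forall fun b => ?_
      rw [norm_mul, Real.norm_of_nonneg (hexp_nn _ _ _)]
      exact mul_le_mul_of_nonneg_right (hexp_le _ _ _) (norm_nonneg _)
    · exact hhi.norm.const_mul _
    · refine Eventually.of_forall fun b => ?_
      exact (Continuous.comp (g := fun q : (GaugeConfig k L G × (Site k L → G)) × GaugeConfig k L G =>
          Real.exp (J * elecSum (d := k) (L := L) ρ q.1.1 q.1.2 q.2))
        (f := fun p : GaugeConfig k L G × (Site k L → G) => (p, b))
        (continuous_exp_elecSum_pair ρ J hρ) (continuous_id.prodMk continuous_const)).mul continuous_const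
  have hFb : ∀ a E, ‖F a E‖ ≤ CE * ∫ b, |h b| ∂(sliceMeasure G k L) := by
    intro a E
    simp only [hF]
    rw [← integral_const_mul]
    refine norm_integral_le_of_norm_le (hhi.abs.const_mul _) (Eventually.of_forall fun b => ?_)
    rw [norm_mul, Real.norm_of_nonneg (hexp_nn _ _ _), Real.norm_eq_abs]
    exact mul_le_mul_of_nonneg_right (hexp_le _ _ _) (abs_nonneg _)
  have hstep2 : ∫ a, (φ : GaugeConfig k L G → ℝ) a * (m a * ∫ E, F a E ∂(Measure.pi fun _ : Site k L => haarProbability G)) ∂(sliceMeasure G k L) =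
      ∫ E, ∫ a, ((φ : GaugeConfig k L G → ℝ) a * m a) * F a E ∂(sliceMeasure G k L) ∂(Measure.pi fun _ : Site k L => haarProbability G) := by
    have h1 : ∀ a, (φ : GaugeConfig k L G → ℝ) a * (m a * ∫ E, F a E ∂(Measure.pi fun _ : Site k L => haarProbability G)) =
        ∫ E, ((φ : GaugeConfig k L G → ℝ) a * m a) * F a E ∂(Measure.pi fun _ : Site k L => haarProbability G) := fun a => by
      rw [← mul_assoc, ← integral_const_mul]
    simp_rw [h1]
    have hint : Integrable (uncurry fun (a : GaugeConfig k L G) (E : Site k L → G) =>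
        ((φ : GaugeConfig k L G → ℝ) a * m a) * F a E) ((sliceMeasure G k L).prod (Measure.pi fun _ : Site k L => haarProbability G)) := by
      have h0 : Integrable (fun p : GaugeConfig k L G × (Site k L → G) =>
          ((φ : GaugeConfig k L G → ℝ) p.1 * m p.1) * (1 : ℝ)) ((sliceMeasure G k L).prod (Measure.pi fun _ : Site k L => haarProbability G)) := hφmi.mul_prod (integrable_const 1)
      have h0' := h0.mul_bdd hFc.aestronglyMeasurable (c := CE * ∫ b, |h b| ∂(sliceMeasure G k L))
        (Eventually.of_forall fun p => hFb p.1 p.2)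
      refine h0'.congr (Eventually.of_forall fun p => ?_)
      simp only [uncurry, mul_one]
    exact integral_integral_swap hint
  rw [hstep2]
  -- Step 3: for each `E`, absorb the temporal links into `φ`
  have hstep3 : ∀ E : Site k L → G, ∫ a, ((φ : GaugeConfig k L G → ℝ) a * m a) * F a E ∂(sliceMeasure G k L) =
      ∫ a, ((φ : GaugeConfig k L G → ℝ) a * m a) * F a 1 ∂(sliceMeasure G k L) := by
    intro E
    have hmp : MeasurePreserving (gaugeTransform E : GaugeConfig k L G → GaugeConfig k L G) (sliceMeasure G k L) (sliceMeasure G k L) :=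
      WilsonGauge.measurePreserving_gaugeTransform E
    set Ψ : GaugeConfig k L G → ℝ := fun a => ((φ : GaugeConfig k L G → ℝ) a * m a) * F a E with hΨ
    have hFE : Continuous fun a : GaugeConfig k L G => F a E :=
      Continuous.comp (g := uncurry F) (f := fun a : GaugeConfig k L G => (a, E)) hFc
        (continuous_id.prodMk continuous_const)
    have hΨm : AEStronglyMeasurable Ψ (sliceMeasure G k L) :=
      ((Lp.aestronglyMeasurable φ).mul hmc.aestronglyMeasurable).mul hFE.aestronglyMeasurable
    -- `∫ Ψ = ∫ Ψ ∘ (·)^E`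
    have h1 : ∫ a, Ψ a ∂(sliceMeasure G k L) = ∫ a, Ψ (gaugeTransform E a) ∂(sliceMeasure G k L) := by
      have hΨm' : AEStronglyMeasurable Ψ (Measure.map (gaugeTransform E) (sliceMeasure G k L)) := by rw [hmp.map_eq]; exact hΨm
      have h := integral_map hmp.measurable.aemeasurable hΨm'
      rw [hmp.map_eq] at h
      exact h
    rw [h1]
    refine integral_congr_ae ?_
    filter_upwards [hφ E] with a ha
    simp only [hΨ, hF, hm]
    rw [ha, magSum_gaugeTransform]
    simp_rw [elecSum_gaugeTransform_left_self ρ E a]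
  simp_rw [hstep3]
  rw [integral_const, probReal_univ, one_smul]
  -- Step 4: the weight at `E = 1` is the product of one-link weights
  refine integral_congr_ae (Eventually.of_forall fun a => ?_)
  simp only [hF, hh, hm]
  simp_rw [exp_elecSum_one_eq_prod ρ J a]

/-! ### The vacuum lower bound `‖T‖ ≥ e^{−|J| n P} c₀^N` -/

/-- **`e^{−|J| n P} c₀^N ≤ ‖T‖`** (`c₀ = ∫ e^{J Re tr ρ}`, `N` links, `P` plaquettes; unitary continuous `ρ`,
`n ≠ 0`): the constant test function `e^{−J mag/2}` — the empty Polyakov path. [cite: MontvayMunster1994, §3.2.6] -/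
theorem norm_tubeTransferOperator_ge (hρ : Continuous ρ) (hρu : ∀ g, ρ g ∈ Matrix.unitaryGroup (Fin n) ℂ) (hn : n ≠ 0)
    {lam : ℝ}
    (hM : ∀ i j, ∫ c, (Real.exp (J * (ρ c).trace.re) : ℂ) * ρ c i j ∂haarProbability G = if i = j then (lam : ℂ) else 0) :
    Real.exp (-(|J| * (n * Fintype.card (Plaquette k L)))) *
        (∫ g, Real.exp (J * (ρ g).trace.re) ∂haarProbability G) ^ Fintype.card (Edge k L) ≤
      ‖tubeTransferOperator ρ J k L‖ := by
  set ℓ : Fin 0 → Edge k L := Fin.elim0 with hℓ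
  set W : GaugeConfig k L G → ℝ := fun b => (ρ ((List.ofFn fun t : Fin 0 => b (ℓ t)).prod)).trace.re with hW
  set f : GaugeConfig k L G → ℝ := fun b => Real.exp (-(J / 2 * magSum (d := k) (L := L) ρ b)) * W b with hf
  set P : ℝ := n * Fintype.card (Plaquette k L) with hP
  have hℓinj : Injective ℓ := fun t => Fin.elim0 t
  have hWn : ∀ b, W b = n := fun b => by
    simp only [hW, List.ofFn_zero, List.prod_nil, map_one, Matrix.trace_one, Fintype.card_fin, Complex.natCast_re]
  have hWc : Continuous W := by
    have : W = fun _ => (n : ℝ) := funext hWn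
    rw [this]; exact continuous_const
  have hfc : Continuous f :=
    (Real.continuous_exp.comp (continuous_const.mul (continuous_magSum (d := k) (L := L) ρ hρ)).neg).mul hWc
  obtain ⟨Cf, hCf⟩ := isCompact_univ.exists_bound_of_continuousOn hfc.continuousOn
  have hmem : MemLp f 2 (sliceMeasure G k L) :=
    MemLp.of_bound hfc.aestronglyMeasurable Cf (Eventually.of_forall fun b => hCf b (Set.mem_univ _))
  have hWg : ∀ (γ : Site k L → G) (b : GaugeConfig k L G),
      (ρ ((List.ofFn fun t : Fin 0 => gaugeTransform γ b (ℓ t)).prod)).trace.re =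
        (ρ ((List.ofFn fun t : Fin 0 => b (ℓ t)).prod)).trace.re := fun γ b => by
    simp only [List.ofFn_zero]
  have hinner := inner_tubeTransferOperator_pathState ρ J hρ hM ℓ hℓinj hWg hmem
  simp only [Nat.sub_zero, pow_zero, mul_one] at hinner
  -- `‖ψ‖² ≤ e^{|J| P} ∫ W²`
  have hW2i : Integrable (fun b => W b ^ 2) (sliceMeasure G k L) :=
    (hWc.pow 2).integrable_of_hasCompactSupport (HasCompactSupport.of_compactSpace _)
  have hnorm : ‖hmem.toLp f‖ ^ 2 ≤ Real.exp (|J| * P) * ∫ b, W b ^ 2 ∂(sliceMeasure G k L) := by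
    rw [norm_sq_eq_integral_sq, ← integral_const_mul]
    have hae := hmem.coeFn_toLp
    refine integral_mono_ae ((Lp.memLp (hmem.toLp f)).integrable_sq) (hW2i.const_mul _) ?_
    filter_upwards [hae] with b hb
    rw [hb]
    simp only [hf]
    rw [mul_pow, ← Real.exp_nat_mul]
    have h2 : ((2 : ℕ) : ℝ) * -(J / 2 * magSum (d := k) (L := L) ρ b) = -(J * magSum (d := k) (L := L) ρ b) := by
      push_cast; ring
    rw [h2]
    exact mul_le_mul_of_nonneg_right (exp_neg_magSum_le ρ J hρu b) (sq_nonneg _)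
  -- `⟪ψ, Tψ⟫ ≤ ‖T‖ ‖ψ‖²`
  have hle : (∫ g, Real.exp (J * (ρ g).trace.re) ∂haarProbability G) ^ Fintype.card (Edge k L) *
      ∫ b, W b ^ 2 ∂(sliceMeasure G k L) ≤ ‖tubeTransferOperator ρ J k L‖ * ‖hmem.toLp f‖ ^ 2 := by
    rw [← hinner]
    refine (real_inner_le_norm _ _).trans ?_
    calc ‖hmem.toLp f‖ * ‖tubeTransferOperator ρ J k L (hmem.toLp f)‖
        ≤ ‖hmem.toLp f‖ * (‖tubeTransferOperator ρ J k L‖ * ‖hmem.toLp f‖) :=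
          mul_le_mul_of_nonneg_left (ContinuousLinearMap.le_opNorm _ _) (norm_nonneg _)
      _ = ‖tubeTransferOperator ρ J k L‖ * ‖hmem.toLp f‖ ^ 2 := by ring
  have hT0 : 0 ≤ ‖tubeTransferOperator ρ J k L‖ := norm_nonneg _
  have h3 : (∫ g, Real.exp (J * (ρ g).trace.re) ∂haarProbability G) ^ Fintype.card (Edge k L) *
      ∫ b, W b ^ 2 ∂(sliceMeasure G k L) ≤
      ‖tubeTransferOperator ρ J k L‖ * (Real.exp (|J| * P) * ∫ b, W b ^ 2 ∂(sliceMeasure G k L)) :=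
    hle.trans (mul_le_mul_of_nonneg_left hnorm hT0)
  have hW2pos : 0 < ∫ b, W b ^ 2 ∂(sliceMeasure G k L) := by
    simp_rw [hWn]
    rw [integral_const, probReal_univ, one_smul]
    exact pow_pos (Nat.cast_pos.2 (Nat.pos_of_ne_zero hn)) 2
  have hexp : 0 < Real.exp (|J| * P) := Real.exp_pos _
  have h4 : (∫ g, Real.exp (J * (ρ g).trace.re) ∂haarProbability G) ^ Fintype.card (Edge k L) ≤
      ‖tubeTransferOperator ρ J k L‖ * Real.exp (|J| * P) :=
    le_of_mul_le_mul_right (by nlinarith [h3]) hW2pos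
  rw [Real.exp_neg]
  calc (Real.exp (|J| * P))⁻¹ * (∫ g, Real.exp (J * (ρ g).trace.re) ∂haarProbability G) ^ Fintype.card (Edge k L)
      ≤ (Real.exp (|J| * P))⁻¹ * (‖tubeTransferOperator ρ J k L‖ * Real.exp (|J| * P)) :=
        mul_le_mul_of_nonneg_left h4 (inv_nonneg.2 hexp.le)
    _ = ‖tubeTransferOperator ρ J k L‖ := by field_simp

end Reduction

end Summit.Ventures.YMGap.FlowData
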